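import Literature.AlgebraicGeometry.HodgeTheory.PolarizedLimitMixedHodgeStructureNilpotentOrbitLimits
import HarnessLib

/-!
# The monodromy weight filtration is the filtration by growth of the Hodge norm along the nilpotent orbit:
# `W_l ⊗ ℂ = {v : ‖exp(xN) v‖²_{θ(x+iy)} = O(y^{l-k})} = {v : ‖exp(xN) v‖²_{θ(x+iy)} = o(y^{l+1-k})}`

Topic `Literature/AlgebraicGeometry/HodgeTheory` (namespace `Literature.AlgebraicGeometry.HodgeTheory.PolarizedLimitMixedHodgeStructure`),
the sequel of `PolarizedLimitMixedHodgeStructureNilpotentOrbitLimits.lean` (the norm estimates as `Tendsto` statements) and of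
`PolarizedLimitMixedHodgeStructureHodgeNormEstimates.lean` (`mem_baseChange_W_iff_exists_hodgeNorm_nilpotentOrbit_le`: `W_l` by a
UNIFORM bound `C y^{(l-k)/2}` beyond `β`).  Here the norm estimates are packaged in Mathlib's asymptotic classes along the rays
`y ↦ x + iy` (`Asymptotics.IsBigO / IsLittleO / IsTheta / IsEquivalent` at `Filter.atTop`), and the weight filtration is
CHARACTERIZED by them. Theorems only; no definition, no instance, no named fact (D-0026 net debt `0`).

PRINTED SOURCE, VERBATIM. W. Schmid, *Variation of Hodge structure: the singularities of the period mapping*, Invent. Math. 22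
(1973), Thm. (6.6) (cite only; as reported in [CarlsonMullerStachPeters2017, §13.1 p. 323] and [CattaniKaplanSchmid1987, §3]): for a
flat section `v`, **`v ∈ W_l` if and only if `‖v‖²_{Φ(z)} = O((Im z)^{l-k})`** (uniformly in `Re z`), and for `v ∈ W_l ∖ W_{l-1}` the
Hodge norm grows EXACTLY like `(Im z)^{(l-k)/2}`; E. Cattani, A. Kaplan, W. Schmid (LNM 1246, 1987), §3 Cor. (3.7): «`‖v‖² =
(-log|s|)^ℓ |v|₀²` for any locally flat section `v ∈ U_ℓ`» up to quasi-isometry; the sentence before (3.7) (p. 21): the `U_ℓ` grade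
`W`: `W_l = ⊕_{ℓ ≤ l-k} U_ℓ`.

WHAT IS FORMALIZED (`F_v(y) := ‖exp(xN) v‖²_{θ(x+iy)}` for `y > α`, extended by `0`; `θ(z) = L.nilpotentOrbit z _`; `|·|₀`, `π̂_l` as
before; every statement for every fixed `x : ℝ`):
* §1 growth classes: `v ∈ W_l ⟹ F_v = O(y^{l-k})` (`isBigO_hodgeNorm_nilpotentOrbit_sq`); `v ∈ W_l ∖ W_{l-1} ⟹ F_v ~ |π̂_l v|₀² · y^{l-k}`
  (`isEquivalent_hodgeNorm_nilpotentOrbit_sq`) and `F_v = Θ(y^{l-k})` (`isTheta_hodgeNorm_nilpotentOrbit_sq`).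
* §2 **THE WEIGHT FILTRATION BY GROWTH**: **`v ∈ W_l ⟺ F_v = o(y^{l+1-k}) ⟺ F_v = O(y^{l-k})`**
  (`mem_baseChange_W_iff_isLittleO`, `mem_baseChange_W_iff_isBigO`; the converse by descent: if `v ∈ W_m`, `m ≥ l+1`, and
  `F_v = o(y^{l+1-k})` then `y^{-(m-k)} F_v → |π̂_m v|₀²` AND `→ 0`, so `π̂_m v = 0`, `v ∈ W_{m-1}`).
* §3 corollaries: **`v ∈ W_k ⟺ ‖exp(xN) v‖_{θ}` bounded** (`mem_baseChange_W_self_iff_isBigO_one`); **`v ∈ W_{k-1} ⟺ ‖exp(xN) v‖_{θ} → 0`**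
  (`mem_baseChange_W_pred_iff_tendsto_zero`); **monodromy invariants have bounded Hodge norm with a limit**: for `N v = 0`,
  `‖v‖_{θ(x+iy)} → |π̂_k v|₀` (`tendsto_hodgeNorm_nilpotentOrbit_of_N_eq_zero`, `isBigO_one_hodgeNorm_nilpotentOrbit_of_N_eq_zero`;
  `ker N ⊆ W_k`, Schmid's Cor. (6.7')).

NOT HERE: several variables; uniformity in `x` (it is in the `∃ y₀ ∀ z` forms of the imported files).

## References

* [Schmid1973] W. Schmid, Invent. Math. 22 (1973): Thm. (6.6), Cor. (6.7') (cite only).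
* [CattaniKaplanSchmid1987] E. Cattani, A. Kaplan, W. Schmid, *Variations of polarized Hodge structure: asymptotics and monodromy*,
  LNM 1246 (1987) 16–31: §3 Cor. (3.7) and the sentence before it (p. 21).
* [CarlsonMullerStachPeters2017] J. Carlson, S. Müller-Stach, C. Peters, *Period Mappings and Period Domains*, 2nd ed. (2017):
  §13.1 p. 323 (Schmid's norm estimates and Cor. (6.7')).
* [Pearlstein2006] G. Pearlstein, J. Differential Geom. 74 (2006): Thm. 4.7 and (4.8).
-/

noncomputable section

open scoped TensorProduct ComplexOrder InnerProductSpace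
open Filter Topology Asymptotics

namespace Literature.AlgebraicGeometry

open Module
open Motives Motives.MixedHodgeStructure Motives.HodgeStructure

universe u

variable {V : Type u} [AddCommGroup V] [Module ℚ V] {k : ℤ}

namespace HodgeTheory

namespace PolarizedLimitMixedHodgeStructure

variable [FiniteDimensional ℚ V] (L : PolarizedLimitMixedHodgeStructure V k)

/-! ## §1 Growth classes of `F_v(y) = ‖exp(xN) v‖²_{θ(x+iy)}` -/

/-- **`v ∈ W_l ⟹ ‖exp(xN) v‖²_{θ(x+iy)} = O(y^{l-k})` as `y → ∞`.** [cite: Schmid1973, Thm. (6.6) (cite only)]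
[cite: CattaniKaplanSchmid1987, §3 Cor. (3.7) and the sentence before it (p. 21)] [cite: Pearlstein2006, Thm. 4.7 and (4.8)] -/
theorem isBigO_hodgeNorm_nilpotentOrbit_sq (x : ℝ) {l : ℤ} {v : ℂ ⊗[ℚ] V} (hv : v ∈ (L.W l).baseChange ℂ) :
    (fun y : ℝ => if h : L.orbitThreshold < y then
        (L.nilpotentOrbitPolarization ⟨x, y⟩ h).hodgeNorm (IsNilpotent.exp ((x : ℂ) • L.N.baseChange ℂ) v) ^ 2 else 0) =O[atTop]
      fun y : ℝ => y ^ (l - k) := by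
  have hG := (L.tendsto_inv_zpow_mul_hodgeNorm_nilpotentOrbit_sq x hv).isBigO_one ℝ
  have h2 := (isBigO_refl (fun y : ℝ => y ^ (l - k)) atTop).mul hG
  refine h2.congr' ?_ (Eventually.of_forall fun y => mul_one _)
  filter_upwards [eventually_gt_atTop L.orbitThreshold] with y hy
  have hy0 : 0 < y := L.orbitThreshold_pos.trans hy
  rw [dif_pos hy, dif_pos hy, mul_inv_cancel_left₀ (zpow_ne_zero _ hy0.ne')]

/-- **`v ∈ W_l ∖ W_{l-1} ⟹ ‖exp(xN) v‖²_{θ(x+iy)} ~ |π̂_l v|₀² · y^{l-k}` as `y → ∞`** (`Asymptotics.IsEquivalent`): the EXACT growth of a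
flat section of exact weight `l`, «`‖v‖² = (-log|s|)^ℓ |v|₀²`» in the limit. [cite: CattaniKaplanSchmid1987, §3 Cor. (3.7) (p. 21)]
[cite: Schmid1973, Thm. (6.6) (cite only)] -/
theorem isEquivalent_hodgeNorm_nilpotentOrbit_sq (x : ℝ) {l : ℤ} {v : ℂ ⊗[ℚ] V} (hv : v ∈ (L.W l).baseChange ℂ)
    (hv' : v ∉ (L.W (l - 1)).baseChange ℂ) :
    (fun y : ℝ => if h : L.orbitThreshold < y then
        (L.nilpotentOrbitPolarization ⟨x, y⟩ h).hodgeNorm (IsNilpotent.exp ((x : ℂ) • L.N.baseChange ℂ) v) ^ 2 else 0) ~[atTop]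
      fun y : ℝ => L.referenceNorm (L.deltaSplit.toMixedHodgeStructure.deligneEProj l v) ^ 2 * y ^ (l - k) := by
  refine isEquivalent_of_tendsto_one ((L.tendsto_hodgeNorm_nilpotentOrbit_sq_div x hv hv').congr' ?_)
  refine Eventually.of_forall fun y => ?_
  simp only [Pi.div_apply]
  split_ifs with h
  · rw [mul_comm (L.referenceNorm _ ^ 2)]
  · rw [zero_div]

/-- **`v ∈ W_l ∖ W_{l-1} ⟹ ‖exp(xN) v‖²_{θ(x+iy)} = Θ(y^{l-k})`.** [cite: Schmid1973, Thm. (6.6) (cite only)] [cite: CattaniKaplanSchmid1987, §3 Cor. (3.7) (p. 21)] -/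
theorem isTheta_hodgeNorm_nilpotentOrbit_sq (x : ℝ) {l : ℤ} {v : ℂ ⊗[ℚ] V} (hv : v ∈ (L.W l).baseChange ℂ)
    (hv' : v ∉ (L.W (l - 1)).baseChange ℂ) :
    (fun y : ℝ => if h : L.orbitThreshold < y then
        (L.nilpotentOrbitPolarization ⟨x, y⟩ h).hodgeNorm (IsNilpotent.exp ((x : ℂ) • L.N.baseChange ℂ) v) ^ 2 else 0) =Θ[atTop]
      fun y : ℝ => y ^ (l - k) := by
  have hp0 : 0 < L.referenceNorm (L.deltaSplit.toMixedHodgeStructure.deligneEProj l v) :=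
    lt_of_le_of_ne (L.referenceNorm_nonneg _) (fun h => hv' ((L.referenceNorm_deligneEProj_eq_zero_iff hv).1 h.symm))
  exact (L.isEquivalent_hodgeNorm_nilpotentOrbit_sq x hv hv').isTheta.trans
    ((isTheta_const_mul_left (pow_pos hp0 2).ne').2 (isTheta_refl _ _))

/-! ## §2 The weight filtration by growth -/

/-- `y^a = o(y^b)` at `∞` for `a < b` (integer exponents). [folklore] -/
private theorem isLittleO_zpow_zpow_atTop {a b : ℤ} (hab : a < b) :
    (fun y : ℝ => y ^ a) =o[atTop] fun y : ℝ => y ^ b := by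
  have hgf : ∀ᶠ y : ℝ in atTop, y ^ b = 0 → y ^ a = 0 := by
    filter_upwards [eventually_gt_atTop 0] with y hy h0
    exact absurd h0 (zpow_ne_zero _ hy.ne')
  rw [isLittleO_iff_tendsto' hgf]
  refine (tendsto_zpow_atTop_zero (sub_neg.2 hab)).congr' ?_
  filter_upwards [eventually_gt_atTop 0] with y hy
  rw [zpow_sub₀ hy.ne']

/-- The descent step: **if `v ∈ W_m`, `m ≥ l + 1`, and `‖exp(xN) v‖²_{θ(x+iy)} = o(y^{l+1-k})`, then `v ∈ W_{m-1}`** —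
`y^{-(m-k)} ‖exp(xN) v‖² → |π̂_m v|₀²` and `→ 0`, so `π̂_m v = 0`. [cite: Schmid1973, Thm. (6.6) (cite only)]
[cite: CattaniKaplanSchmid1987, §3 Cor. (3.7) and the sentence before it (p. 21)] -/
theorem mem_baseChange_W_pred_of_isLittleO (x : ℝ) {l m : ℤ} (hlm : l + 1 ≤ m) {v : ℂ ⊗[ℚ] V}
    (hv : v ∈ (L.W m).baseChange ℂ)
    (ho : (fun y : ℝ => if h : L.orbitThreshold < y then
        (L.nilpotentOrbitPolarization ⟨x, y⟩ h).hodgeNorm (IsNilpotent.exp ((x : ℂ) • L.N.baseChange ℂ) v) ^ 2 else 0) =o[atTop]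
      fun y : ℝ => y ^ (l + 1 - k)) :
    v ∈ (L.W (m - 1)).baseChange ℂ := by
  have h1 := L.tendsto_inv_zpow_mul_hodgeNorm_nilpotentOrbit_sq x hv
  -- the same function tends to `0`
  have h2 : Tendsto (fun y : ℝ => if h : L.orbitThreshold < y then
      (y ^ (m - k))⁻¹ * (L.nilpotentOrbitPolarization ⟨x, y⟩ h).hodgeNorm (IsNilpotent.exp ((x : ℂ) • L.N.baseChange ℂ) v) ^ 2
      else 0) atTop (𝓝 0) := by
    have hb : IsBoundedUnder (· ≤ ·) atTop fun y : ℝ => |y ^ (l + 1 - m)| := by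
      refine isBoundedUnder_of_eventually_le (a := (1 : ℝ)) ?_
      filter_upwards [eventually_ge_atTop 1] with y hy
      rw [abs_of_nonneg (zpow_nonneg (zero_le_one.trans hy) _)]
      exact zpow_le_one_of_nonpos₀ hy (by omega)
    refine (ho.tendsto_div_nhds_zero.zero_mul_isBoundedUnder_le hb).congr' ?_
    filter_upwards [eventually_gt_atTop L.orbitThreshold] with y hy
    have hy0 : 0 < y := L.orbitThreshold_pos.trans hy
    have hyz : ∀ j : ℤ, y ^ j ≠ 0 := fun j => zpow_ne_zero j hy0.ne'
    rw [dif_pos hy, dif_pos hy, eq_inv_mul_iff_mul_eq₀ (hyz _)]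
    calc y ^ (m - k) * ((L.nilpotentOrbitPolarization ⟨x, y⟩ hy).hodgeNorm (IsNilpotent.exp ((x : ℂ) • L.N.baseChange ℂ) v) ^ 2 /
          y ^ (l + 1 - k) * y ^ (l + 1 - m))
        = (L.nilpotentOrbitPolarization ⟨x, y⟩ hy).hodgeNorm (IsNilpotent.exp ((x : ℂ) • L.N.baseChange ℂ) v) ^ 2 *
            (y ^ (m - k) * y ^ (l + 1 - m) / y ^ (l + 1 - k)) := by ring
      _ = _ := by rw [← zpow_add₀ hy0.ne', show m - k + (l + 1 - m) = l + 1 - k by ring, div_self (hyz _), mul_one]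
  have h0 : L.referenceNorm (L.deltaSplit.toMixedHodgeStructure.deligneEProj m v) ^ 2 = 0 := tendsto_nhds_unique h1 h2
  exact (L.referenceNorm_deligneEProj_eq_zero_iff hv).1 (pow_eq_zero_iff two_ne_zero |>.1 h0)

/-- **THE WEIGHT FILTRATION BY GROWTH, `o`-form: `v ∈ W_l ⟺ ‖exp(xN) v‖²_{θ(x+iy)} = o(y^{l+1-k})` as `y → ∞`** (any fixed `x`).
[cite: Schmid1973, Thm. (6.6) (cite only)] [cite: CattaniKaplanSchmid1987, §3 Cor. (3.7) and the sentence before it (p. 21)]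
[cite: Pearlstein2006, Thm. 4.7 and (4.8)] -/
theorem mem_baseChange_W_iff_isLittleO (x : ℝ) (l : ℤ) (v : ℂ ⊗[ℚ] V) :
    v ∈ (L.W l).baseChange ℂ ↔
      (fun y : ℝ => if h : L.orbitThreshold < y then
          (L.nilpotentOrbitPolarization ⟨x, y⟩ h).hodgeNorm (IsNilpotent.exp ((x : ℂ) • L.N.baseChange ℂ) v) ^ 2 else 0) =o[atTop]
        fun y : ℝ => y ^ (l + 1 - k) := by
  refine ⟨fun hv => (L.isBigO_hodgeNorm_nilpotentOrbit_sq x hv).trans_isLittleO (isLittleO_zpow_zpow_atTop (by omega)),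
    fun ho => ?_⟩
  -- descent from a top weight
  have hdesc : ∀ n : ℕ, v ∈ (L.W (l + n)).baseChange ℂ → v ∈ (L.W l).baseChange ℂ := by
    intro n
    induction n with
    | zero => simp
    | succ n ih =>
      intro hv
      refine ih ?_
      have h := L.mem_baseChange_W_pred_of_isLittleO x (m := l + (n + 1 : ℕ)) (by push_cast; omega) hv ho
      rwa [show l + ((n + 1 : ℕ) : ℤ) - 1 = l + (n : ℕ) by push_cast; ring] at h
  obtain ⟨t, ht⟩ := L.exists_W_eq_top
  have hvt : v ∈ (L.W t).baseChange ℂ := by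
    rw [ht, Submodule.baseChange_top]
    exact Submodule.mem_top
  by_cases hlt : l ≤ t
  · refine hdesc (t - l).toNat ?_
    rwa [Int.toNat_of_nonneg (sub_nonneg.2 hlt), add_sub_cancel]
  · exact Submodule.baseChange_mono ℂ (L.monotone_W (le_of_lt (not_le.1 hlt))) hvt

/-- **THE WEIGHT FILTRATION BY GROWTH, `O`-form: `v ∈ W_l ⟺ ‖exp(xN) v‖²_{θ(x+iy)} = O(y^{l-k})` as `y → ∞`** — Schmid's
characterization of the monodromy weight filtration by the growth of the Hodge norms of flat sections. [cite: Schmid1973, Thm. (6.6) (cite only)]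
[cite: CarlsonMullerStachPeters2017, §13.1 p. 323] [cite: CattaniKaplanSchmid1987, §3 Cor. (3.7) and the sentence before it (p. 21)] -/
theorem mem_baseChange_W_iff_isBigO (x : ℝ) (l : ℤ) (v : ℂ ⊗[ℚ] V) :
    v ∈ (L.W l).baseChange ℂ ↔
      (fun y : ℝ => if h : L.orbitThreshold < y then
          (L.nilpotentOrbitPolarization ⟨x, y⟩ h).hodgeNorm (IsNilpotent.exp ((x : ℂ) • L.N.baseChange ℂ) v) ^ 2 else 0) =O[atTop]
        fun y : ℝ => y ^ (l - k) :=
  ⟨fun hv => L.isBigO_hodgeNorm_nilpotentOrbit_sq x hv, fun hO =>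
    (L.mem_baseChange_W_iff_isLittleO x l v).2 (hO.trans_isLittleO (isLittleO_zpow_zpow_atTop (by omega)))⟩

/-! ## §3 Corollaries: `W_k` = bounded sections, `W_{k-1}` = decaying sections, monodromy invariants -/

/-- **`v ∈ W_k ⟺ ‖exp(xN) v‖_{θ(x+iy)}` is bounded as `y → ∞`** (`= O(1)`). [cite: Schmid1973, Thm. (6.6) (cite only)]
[cite: Pearlstein2006, Thm. 4.7 and (4.8)] [cite: CarlsonMullerStachPeters2017, §13.1 p. 323] -/
theorem mem_baseChange_W_self_iff_isBigO_one (x : ℝ) (v : ℂ ⊗[ℚ] V) :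
    v ∈ (L.W k).baseChange ℂ ↔
      (fun y : ℝ => if h : L.orbitThreshold < y then
          (L.nilpotentOrbitPolarization ⟨x, y⟩ h).hodgeNorm (IsNilpotent.exp ((x : ℂ) • L.N.baseChange ℂ) v) ^ 2 else 0) =O[atTop]
        fun _ : ℝ => (1 : ℝ) := by
  rw [L.mem_baseChange_W_iff_isBigO x k v]
  exact ⟨fun h => h.congr_right (fun y => by rw [sub_self, zpow_zero]), fun h => h.congr_right (fun y => by rw [sub_self, zpow_zero])⟩

/-- **`v ∈ W_{k-1} ⟺ ‖exp(xN) v‖_{θ(x+iy)} → 0` as `y → ∞`.** [cite: Schmid1973, Thm. (6.6) (cite only)]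
[cite: CattaniKaplanSchmid1987, §3 Cor. (3.7) and the sentence before it (p. 21)] -/
theorem mem_baseChange_W_pred_iff_tendsto_zero (x : ℝ) (v : ℂ ⊗[ℚ] V) :
    v ∈ (L.W (k - 1)).baseChange ℂ ↔
      Tendsto (fun y : ℝ => if h : L.orbitThreshold < y then
          (L.nilpotentOrbitPolarization ⟨x, y⟩ h).hodgeNorm (IsNilpotent.exp ((x : ℂ) • L.N.baseChange ℂ) v) ^ 2 else 0)
        atTop (𝓝 0) := by
  refine ⟨fun hv => L.tendsto_hodgeNorm_nilpotentOrbit_sq_nhds_zero x (by omega) hv, fun h => ?_⟩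
  rw [L.mem_baseChange_W_iff_isLittleO x (k - 1) v]
  exact ((isLittleO_one_iff ℝ).2 h).congr_right (fun y => by rw [show k - 1 + 1 - k = 0 by ring, zpow_zero])

omit [FiniteDimensional ℚ V] in
/-- `exp(A) v = v` when `A v = 0` (`A` nilpotent). [folklore] -/
private theorem exp_apply_eq_self_of_apply_eq_zero {A : Module.End ℂ (ℂ ⊗[ℚ] V)} (hA : IsNilpotent A)
    {v : ℂ ⊗[ℚ] V} (hv : A v = 0) : IsNilpotent.exp A v = v := by
  obtain ⟨n, hn⟩ := hA
  have hn' : A ^ (n + 1) = 0 := by rw [pow_succ, hn, zero_mul]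
  have hpow : ∀ i : ℕ, (A ^ (i + 1)) v = 0 := fun i => by rw [pow_succ, Module.End.mul_apply, hv, map_zero]
  rw [IsNilpotent.exp_eq_sum hn', LinearMap.sum_apply, Finset.sum_range_succ']
  simp only [LinearMap.smul_apply, hpow, smul_zero, Finset.sum_const_zero, zero_add, pow_zero, Module.End.one_apply,
    Nat.factorial_zero, Nat.cast_one, inv_one, one_smul]

/-- **Monodromy invariants have bounded Hodge norm, with a limit: `N v = 0 ⟹ ‖v‖_{θ(x+iy)} → |π̂_k v|₀`** (`ker N ⊆ W_k` and
`exp(xN) v = v`). [cite: Schmid1973, Cor. (6.7') (cite only)] [cite: CarlsonMullerStachPeters2017, §13.1 p. 323] [cite: Pearlstein2006, Thm. 4.7 (a)] -/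
theorem tendsto_hodgeNorm_nilpotentOrbit_of_N_eq_zero (x : ℝ) {v : ℂ ⊗[ℚ] V} (hv : L.N.baseChange ℂ v = 0) :
    Tendsto (fun y : ℝ => if h : L.orbitThreshold < y then (L.nilpotentOrbitPolarization ⟨x, y⟩ h).hodgeNorm v else 0) atTop
      (𝓝 (L.referenceNorm (L.deltaSplit.toMixedHodgeStructure.deligneEProj k v))) := by
  have hvW : v ∈ (L.W k).baseChange ℂ := by
    have hker : v ∈ (LinearMap.ker L.N).baseChange ℂ := (HodgeStructure.mem_baseChange_ker_iff L.N v).2 hv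
    exact Submodule.baseChange_mono ℂ L.ker_N_le_W hker
  have hexp : IsNilpotent.exp ((x : ℂ) • L.N.baseChange ℂ) v = v :=
    exp_apply_eq_self_of_apply_eq_zero (L.isNilpotent_N_baseChange.smul _) (by rw [LinearMap.smul_apply, hv, smul_zero])
  have h := L.tendsto_hodgeNorm_nilpotentOrbit_of_mem_baseChange_W x hvW
  rw [hexp] at h
  exact h

/-- **`N v = 0 ⟹ ‖v‖_{θ(x+iy)} = O(1)`**: invariant sections are bounded in the Hodge metric along the orbit.
[cite: Schmid1973, Cor. (6.7') (cite only)] [cite: CarlsonMullerStachPeters2017, §13.1 p. 323] -/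
theorem isBigO_one_hodgeNorm_nilpotentOrbit_of_N_eq_zero (x : ℝ) {v : ℂ ⊗[ℚ] V} (hv : L.N.baseChange ℂ v = 0) :
    (fun y : ℝ => if h : L.orbitThreshold < y then (L.nilpotentOrbitPolarization ⟨x, y⟩ h).hodgeNorm v else 0) =O[atTop]
      fun _ : ℝ => (1 : ℝ) :=
  (L.tendsto_hodgeNorm_nilpotentOrbit_of_N_eq_zero x hv).isBigO_one ℝ

end PolarizedLimitMixedHodgeStructure

end HodgeTheory

end Literature.AlgebraicGeometry

end
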